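import Summits.ResolutionOfSingularities.ResolutionOfSingularities.Theorems.HilbertSamuelEliminationCampaignW42ProjDirLineRelative
import Literature.AlgebraicGeometry.Resolution.RegularSubschemeLocallyIrreducible
import Literature.AlgebraicGeometry.Resolution.SubschemeRegularStalks
import HarnessLib

/-!
# [OURS · L1 W4.2] P-b in the BINDER SHAPE (B4) of chain w42's (R2) consumer: near points over a point `y` of a
# permissible centre `D` with `𝓘_{D,y} = 𝔪_y` and `e_y = 1` are `κ(y)`-RATIONAL (and unique, and on `ℙ(Dir_y)`) — print
# door (F1) modulo `Thm314_point_locus`, and the fact-free door `ē_y = 1` (campaign s42, cell res-hironaka; res-L1-w42-stub-2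
# PATH-ANNOUNCE (R2) 2026-08-27T09:52:42Z binder (B4); crux stmt-ResolutionOfSingularities-18506 / conjunct 19249; `--supports`)

HONEST FRAMING. OURS (slot W4.2, prover res-L1-s42-pv-1, gen 4). res-L1-w42-stub-2's (R2) file «NEAR LOCUS OVER A CURVE
CENTRE» takes, by SHAPE, the binder

  (B4) `∀ X X' (π : X' ⟶ X) (D), IsExcellent X → IsPermissible D → IsBlowup π D → ∀ N, dim X ≤ N → ∀ x', π x' ∈ V(D) →
        𝓘_{D, π x'} = 𝔪_{π x'} → CharHypothesis X (π x') → e_{π x'}(X) = 1 → H^N_{X'}(x') = H^N_X(π x') → IsIso (κ(π x') → κ(x'))`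

(«residual rationality half of s42-pv-1's char door»). This file PROVES (B4) in exactly that binder order from the char door
`nearFibre_subsingleton_of_charHypothesis` of `…CampaignW42ProjDirLineRelative` (p521339) — so the consumer feeds
`CampaignW42.isIso_residueFieldMap_of_near_of_charHypothesis h314` where it holds `(h314 : Thm314_point_locus)` — together
with its uniqueness and `ℙ(Dir)` companions in the same shape, and the FACT-FREE twins with `CharHypothesis X (π x')` and
`dim X ≤ N` replaced by `ē_{π x'}(X) = 1` (no binder at all). Bridge: a permissible `D` is a regular closed subscheme, hence
`D = 𝓘(V(D))` (`eq_vanishingIdeal_support_of_isRegular`), and `𝓘_{D,y} = 𝔪_y` gives (loc) `(Spec 𝒪_{X,y} → X)⁻¹ V(D) = {𝔪_y}`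
(stub-2's `Moving.preimage_support_fromSpecStalk_eq_singleton`).

NOTHING here is a statement of H. Hironaka's manuscript [Hironaka2017]; the print door carries CJS Thm. 3.14 (point centres)
BY NAME and asserts nothing about it. AI review is weaker than expert review. References (orientation only): V. Cossart,
U. Jannsen, S. Saito, LNM 2270 (2020), Thm. 3.14, Def. 6.34 (i), p. 103 L32, p. 104.
-/

noncomputable section

-- single-conjunct summit: the doubled namespace component `ResolutionOfSingularities` is mandated
set_option linter.dupNamespace false

open CategoryTheory CategoryTheory.Limits AlgebraicGeometry TopologicalSpace IsLocalRing
open Literature.AlgebraicGeometry.Resolution Literature.AlgebraicGeometry.CossartJannsenSaito2020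
open Literature.RingTheory.HilbertSamuel
open Scheme.IdealSheafData

namespace Summit.ResolutionOfSingularities.ResolutionOfSingularities.Theorems

namespace CampaignW42

universe u

section Bridge

variable {X X' : Scheme.{u}} [IsLocallyNoetherian X] {π : X' ⟶ X} {D : X.IdealSheafData}

/-- A permissible centre is the reduced ideal of its support: `D = 𝓘(V(D))` (CJS Def. 3.1 (2): `V(D)` is regular, hence
reduced). [cite: CossartJannsenSaito2020, Def. 3.1 (2)] -/
theorem eq_vanishingIdeal_support_of_isPermissible (hD : IdealSheafData.IsPermissible D) : D = vanishingIdeal D.support :=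
  eq_vanishingIdeal_support_of_isRegular D
    ((Scheme.isRegular_subscheme_iff D).mpr fun x hx => (hD x hx).isRegularLocalRing)

omit [IsLocallyNoetherian X] in
/-- **(loc) from `𝓘_{D,y} = 𝔪_y`**: the generizations of `y` meet `V(D)` only in `y` (stub-2's
`Moving.preimage_support_fromSpecStalk_eq_singleton` at the closed point). [cite: StacksProject, Tag 01J7] -/
theorem preimage_support_fromSpecStalk_eq_singleton_of_stalkIdeal_eq {y : X}
    (hDy : stalkIdeal D y = maximalIdeal (X.presheaf.stalk y)) :
    (X.fromSpecStalk y).base ⁻¹' (D.support : Set X) = {closedPoint (X.presheaf.stalk y)} :=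
  SigmaMaxModificationsCorridor3.Moving.preimage_support_fromSpecStalk_eq_singleton D hDy Scheme.fromSpecStalk_closedPoint

/-- The blow-up along a permissible `D` is the blow-up in the reduced closed set `V(D)`. [cite: CossartJannsenSaito2020, Def. 3.1] -/
theorem isBlowup_vanishingIdeal_support_of_isPermissible (hD : IdealSheafData.IsPermissible D) (hπ : IsBlowup π D) :
    IsBlowup π (vanishingIdeal D.support) := by
  rw [← eq_vanishingIdeal_support_of_isPermissible hD]
  exact hπ

end Bridge

/-! ## (B4) and companions — print door (F1), modulo `Thm314_point_locus` -/

/-- **(B4), verbatim binder shape of res-L1-w42-stub-2's (R2) file — RESIDUAL RATIONALITY of the near point over a point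
`y = π x'` of a permissible centre with `𝓘_{D,y} = 𝔪_y`, (F1) and `e_y(X) = 1`** (CJS p. 103 L32 / p. 104 «`k(η_{q−1}) = k(η_q)`»),
modulo the typed print binder `Thm314_point_locus`. [cite: CossartJannsenSaito2020, Thm. 3.14, Def. 6.34 (i), p. 104] -/
theorem isIso_residueFieldMap_of_near_of_charHypothesis (h314 : Thm314_point_locus.{u}) :
    ∀ (X X' : Scheme.{u}) [IsLocallyNoetherian X] [IsLocallyNoetherian X'] (π : X' ⟶ X) (D : X.IdealSheafData),
      Scheme.IsExcellent X → IdealSheafData.IsPermissible D → IsBlowup π D →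
        ∀ N : ℕ, topologicalKrullDim ↥X ≤ (N : WithBot ℕ∞) →
          ∀ x' : X', π.base x' ∈ (D.support : Set X) →
            stalkIdeal D (π.base x') = maximalIdeal (X.presheaf.stalk (π.base x')) → CharHypothesis X (π.base x') →
              Scheme.dirDim X (π.base x') = 1 → Scheme.hsFun X' N x' = Scheme.hsFun X N (π.base x') →
                IsIso (π.residueFieldMap x') := by
  intro X X' _ _ π D hX hD hπ N hN x' _ hDy hchar he hnear
  exact ((nearFibre_subsingleton_of_charHypothesis h314 hX hN (isBlowup_vanishingIdeal_support_of_isPermissible hD hπ)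
    (preimage_support_fromSpecStalk_eq_singleton_of_stalkIdeal_eq hDy) hchar he).2 x' rfl hnear).1

/-- (B4)'s `ℙ(Dir)` companion: the near point lies on `ℙ(Dir_y(X))` (`IsOnProjDirectrix π x'`), same binders.
[cite: CossartJannsenSaito2020, Thm. 3.14, p. 104] -/
theorem isOnProjDirectrix_of_near_of_charHypothesis' (h314 : Thm314_point_locus.{u}) :
    ∀ (X X' : Scheme.{u}) [IsLocallyNoetherian X] [IsLocallyNoetherian X'] (π : X' ⟶ X) (D : X.IdealSheafData),
      Scheme.IsExcellent X → IdealSheafData.IsPermissible D → IsBlowup π D →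
        ∀ N : ℕ, topologicalKrullDim ↥X ≤ (N : WithBot ℕ∞) →
          ∀ x' : X', π.base x' ∈ (D.support : Set X) →
            stalkIdeal D (π.base x') = maximalIdeal (X.presheaf.stalk (π.base x')) → CharHypothesis X (π.base x') →
              Scheme.dirDim X (π.base x') = 1 → Scheme.hsFun X' N x' = Scheme.hsFun X N (π.base x') →
                IsOnProjDirectrix π x' := by
  intro X X' _ _ π D hX hD hπ N hN x' _ hDy hchar he hnear
  exact ((nearFibre_subsingleton_of_charHypothesis h314 hX hN (isBlowup_vanishingIdeal_support_of_isPermissible hD hπ)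
    (preimage_support_fromSpecStalk_eq_singleton_of_stalkIdeal_eq hDy) hchar he).2 x' rfl hnear).2

/-- (B4)'s UNIQUENESS companion: the points over `y` near to `y` form a subsingleton, same binders read at `y`.
[cite: CossartJannsenSaito2020, Thm. 3.14, p. 104] -/
theorem nearFibre_subsingleton_of_charHypothesis' (h314 : Thm314_point_locus.{u}) :
    ∀ (X X' : Scheme.{u}) [IsLocallyNoetherian X] [IsLocallyNoetherian X'] (π : X' ⟶ X) (D : X.IdealSheafData),
      Scheme.IsExcellent X → IdealSheafData.IsPermissible D → IsBlowup π D →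
        ∀ N : ℕ, topologicalKrullDim ↥X ≤ (N : WithBot ℕ∞) →
          ∀ y : X, y ∈ (D.support : Set X) → stalkIdeal D y = maximalIdeal (X.presheaf.stalk y) → CharHypothesis X y →
            Scheme.dirDim X y = 1 →
              {x' : X' | π.base x' = y ∧ Scheme.hsFun X' N x' = Scheme.hsFun X N y}.Subsingleton := by
  intro X X' _ _ π D hX hD hπ N hN y _ hDy hchar he
  exact (nearFibre_subsingleton_of_charHypothesis h314 hX hN (isBlowup_vanishingIdeal_support_of_isPermissible hD hπ)
    (preimage_support_fromSpecStalk_eq_singleton_of_stalkIdeal_eq hDy) hchar he).1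

/-! ## The fact-free twins: `CharHypothesis` and `dim X ≤ N` replaced by `ē_y(X) = 1` -/

/-- **(B4♭) fact-free**: residual rationality of the near point over `y = π x'` with `𝓘_{D,y} = 𝔪_y` and
**`e_y(X) = ē_y(X) = 1`** — every characteristic, no characteristic hypothesis, no named fact, no `dim X ≤ N`.
[cite: CossartJannsenSaito2020, p. 104, (6.24)] -/
theorem isIso_residueFieldMap_of_near_of_geomDirDim_eq_one :
    ∀ (X X' : Scheme.{u}) [IsLocallyNoetherian X] [IsLocallyNoetherian X'] (π : X' ⟶ X) (D : X.IdealSheafData),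
      Scheme.IsExcellent X → IdealSheafData.IsPermissible D → IsBlowup π D →
        ∀ (N : ℕ) (x' : X'), π.base x' ∈ (D.support : Set X) →
          stalkIdeal D (π.base x') = maximalIdeal (X.presheaf.stalk (π.base x')) →
            Scheme.dirDim X (π.base x') = 1 → Scheme.geomDirDim X (π.base x') = 1 →
              Scheme.hsFun X' N x' = Scheme.hsFun X N (π.base x') → IsIso (π.residueFieldMap x') := by
  intro X X' _ _ π D hX hD hπ N x' _ hDy he hē hnear
  exact ((nearFibre_subsingleton_of_dirDim_eq_geomDirDim_eq_one hX (isBlowup_vanishingIdeal_support_of_isPermissible hD hπ)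
    (preimage_support_fromSpecStalk_eq_singleton_of_stalkIdeal_eq hDy) he hē N).2 x' rfl hnear).1

/-- (B4♭)'s `ℙ(Dir)` companion, fact-free. [cite: CossartJannsenSaito2020, p. 104, Thm. 3.14] -/
theorem isOnProjDirectrix_of_near_of_geomDirDim_eq_one :
    ∀ (X X' : Scheme.{u}) [IsLocallyNoetherian X] [IsLocallyNoetherian X'] (π : X' ⟶ X) (D : X.IdealSheafData),
      Scheme.IsExcellent X → IdealSheafData.IsPermissible D → IsBlowup π D →
        ∀ (N : ℕ) (x' : X'), π.base x' ∈ (D.support : Set X) →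
          stalkIdeal D (π.base x') = maximalIdeal (X.presheaf.stalk (π.base x')) →
            Scheme.dirDim X (π.base x') = 1 → Scheme.geomDirDim X (π.base x') = 1 →
              Scheme.hsFun X' N x' = Scheme.hsFun X N (π.base x') → IsOnProjDirectrix π x' := by
  intro X X' _ _ π D hX hD hπ N x' _ hDy he hē hnear
  exact ((nearFibre_subsingleton_of_dirDim_eq_geomDirDim_eq_one hX (isBlowup_vanishingIdeal_support_of_isPermissible hD hπ)
    (preimage_support_fromSpecStalk_eq_singleton_of_stalkIdeal_eq hDy) he hē N).2 x' rfl hnear).2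

/-- (B4♭)'s UNIQUENESS companion, fact-free. [cite: CossartJannsenSaito2020, p. 104] -/
theorem nearFibre_subsingleton_of_geomDirDim_eq_one :
    ∀ (X X' : Scheme.{u}) [IsLocallyNoetherian X] [IsLocallyNoetherian X'] (π : X' ⟶ X) (D : X.IdealSheafData),
      Scheme.IsExcellent X → IdealSheafData.IsPermissible D → IsBlowup π D →
        ∀ (N : ℕ) (y : X), y ∈ (D.support : Set X) → stalkIdeal D y = maximalIdeal (X.presheaf.stalk y) →
          Scheme.dirDim X y = 1 → Scheme.geomDirDim X y = 1 →
            {x' : X' | π.base x' = y ∧ Scheme.hsFun X' N x' = Scheme.hsFun X N y}.Subsingleton := by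
  intro X X' _ _ π D hX hD hπ N y _ hDy he hē
  exact (nearFibre_subsingleton_of_dirDim_eq_geomDirDim_eq_one hX (isBlowup_vanishingIdeal_support_of_isPermissible hD hπ)
    (preimage_support_fromSpecStalk_eq_singleton_of_stalkIdeal_eq hDy) he hē N).1

end CampaignW42

end Summit.ResolutionOfSingularities.ResolutionOfSingularities.Theorems

end
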